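import Mathlib
import Summits.Ventures.PercRepro.PuncturedLYMUnif56Table

/-!
# PercRepro — (SP) FOR ANY NUMBER OF PAIRWISE DISJOINT `5`-SETS AT LEVEL `6`: THE COLUMN IDENTITIES (5)
(p10, gen 40)

For each free column class `(d1, …, d4)` (`Σ v d_v ≤ 7`): the `v d_v` rows obtained by removing a point of a member met in `v`
points (class `d − e_v + e_{v−1}`, direction `v − 1`) and the `7 − Σ v d_v` rows obtained by removing a free point (class `d`,
direction `5`) carry total weight `1`.  The member columns carry `5 · (1/5) = 1`.  Nothing here asserts (SP).
-/

namespace PercRepro.PuncturedLYM.Split.TypeLift.Unif56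

set_option maxHeartbeats 4000000 in
set_option maxRecDepth 20000 in
/-- The column identity of the free column class `(5, 1, 0, 0)`. -/
theorem col_5100 (n k : ℚ) (hQ : Qp n k ≠ 0) (hP : Pp n k ≠ 0) :
    1 * 5 * raw n k 4 1 0 0 0 + 2 * 1 * raw n k 6 0 0 0 1 = 1 := by
  simp (config := {decide := true}) only [raw, sel, sel_4100, sel_6000, if_true, if_false]
  field_simp
  unfold Qp Pp N_4100_D0 N_6000_D1
  ring

set_option maxHeartbeats 4000000 in
set_option maxRecDepth 20000 in
/-- The column identity of the free column class `(7, 0, 0, 0)`. -/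
theorem col_7000 (n k : ℚ) (hQ : Qp n k ≠ 0) (hP : Pp n k ≠ 0) :
    1 * 7 * raw n k 6 0 0 0 0 = 1 := by
  simp (config := {decide := true}) only [raw, sel, sel_6000, if_true, if_false]
  field_simp
  unfold Qp Pp N_6000_D0
  ring

end PercRepro.PuncturedLYM.Split.TypeLift.Unif56
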